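import Summits.ResolutionOfSingularities.ResolutionOfSingularities.Theses.FrobeniusLadder
import Summits.ResolutionOfSingularities.ResolutionOfSingularities.Theorems.FRationalResolution.Negative.FiniteTypeLoadBearing
import Literature.AlgebraicGeometry.Resolution.QuasiProjectiveResolution
import Literature.AlgebraicGeometry.Resolution.CanonicalResolutionProofs
import Literature.AlgebraicGeometry.Resolution.RegularLocusDense
import Literature.AlgebraicGeometry.Resolution.ResolutionOfComponents
import Mathlib.AlgebraicGeometry.FunctionField
import Summits.ResolutionOfSingularities.ResolutionOfSingularities.Theorems.FrobeniusLadderFRationalResolutionStubRungsOfSummit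
import HarnessLib

/-! # Disproof of `FRationalResolution` — findings (crux stmt-ResolutionOfSingularities-15317, route FrobeniusLadder)

Standing disprover `refuter-cdisprove-stmt-ResolutionOfSingularities-15317-0`, cycle 1 (2026-08-16).

VERDICT SO FAR: NO KILL IS POSSIBLE SHORT OF `¬ ResolutionOfSingularities` — the crux is the summit restricted
to the residual class (theorem `not_summit_of_not_fRationalResolution`, §0). Everything below is therefore
LOAD-BEARING / FAITHFULNESS analysis for the provers and the planner, all kernel-checked.

* §0 Sandwich. `¬crux → ¬summit` (`not_summit_of_not_fRationalResolution`); `crux → crux-without-IsReduced`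
  (`fRationalResolution_imp_withoutReduced`: the hypothesis `IsReduced X` is REDUNDANT — the F-rational model
  `X'` is reduced, separated and of finite type over `k` through `π ≫ f`, is its own model along `𝟙 X'`, and
  resolutions transport along `π`). Provers may ignore `hred`.
* §1 Faithfulness of the typed stalk clause ("every ideal generated by a full s.o.p. is tightly closed",
  with `∀ e ≥ 0` in place of `e ≫ 0`): `exists_forall_of_eventually` (in a domain the two closures agree:
  replace `c` by `c·y^(p^e₀)`); `clause_of_field` (dimension-0 stalks = function fields satisfy it, so the
  clause is never vacuous); `not_forall_mem_span_pow_of_clause` (the clause forces `⋂ₙ (tⁿ) ∌ c ≠ 0` for every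
  `t` with `√(t) = 𝔪` once `d ≥ 1`: automatic for Noetherian stalks (Krull), it is exactly what excludes
  valuation rings of rank ≥ 2 while ADMITTING non-Noetherian rank-1 behaviour — see §2).
* §2 Load-bearing hypotheses (drop one at a time):
  - `LocallyOfFiniteType f`: LOAD-BEARING, LANDED — `Theorems/FRationalResolution/Negative/PerfectClosureLevels.lean`
    (p129263: `Core.mem_span_of_total_of_archimedean`, `Witness.*`) and
    `Theorems/FRationalResolution/Negative/FiniteTypeLoadBearing.lean`
    (`Negative.fRationalResolution_false_without_locallyOfFiniteType[_at]`, `Negative.clause_localizationAtPrime`),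
    re-exported below as `fRationalResolution_false_without_locallyOfFiniteType :
    ¬ FRationalResolutionWithoutLocallyOfFiniteType`. Witness `X = X' = Spec (PerfectClosure 𝔽_p[X] p)`, `π = 𝟙`:
    every stalk is a (non-Noetherian!) domain satisfying the clause — localizations of the perfection of `𝔽_p[X]`
    are totally ordered by divisibility and archimedean, and in any such domain every f.g. ideal is tightly
    closed in the inline sense — while `Spec` of a perfect domain with non-open generic point has no resolution
    (`Literature…not_hasResolution_spec_of_forall_exists_pow_eq`). MORAL: the clause alone does not make stalks
    Noetherian/excellent; any proof must take that from `LocallyOfFiniteType f`.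
  - `IsReduced X`: REDUNDANT (§0).
  - `IsBirational π`: without it the crux IS the summit (`X' = ∅` is then a proper model of every `X`):
    theorem `withoutIsBirational_iff_summit` (§2); with it, `X' = ∅` is NOT a junk model (a dense `U ⊆ X`
    with `π ∣_ U` an iso from `∅` forces `X = ∅`).
  - `IsProper π`: without it the crux IS the summit (`X'` = regular locus `Reg X ↪ X`: open by Matsumura
    30.5 Cor. — `isOpen_regularLocus_of_locallyOfFiniteType_field`, in the tree —, dense for reduced `X`,
    regular stalks satisfy the clause): theorem `withoutIsProper_iff_summit` (§2).
  - `p.Prime` / `CharP k p`: COSMETIC (`p = 0`, i.e. `CharP k 0`: the clause at `e ≥ 1` reads `c ∈ ⊤` since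
    `0^e = 0`, and at `e = 0` it reads `c·y ∈ (s) ⇒ y ∈ (s)`, which fails in every Noetherian local domain of
    dimension `d ≥ 1` (`y = 1`, `c` a non-zero parameter), so every stalk of a model `X'` is a FIELD, `X'` is
    regular and `π` itself is a resolution — the `p = 0` instance is TRUE; composite `p` or `p = 1`:
    `CharP k p` is uninhabited for a field, vacuous). Not formalised (needs existence of systems of
    parameters to instantiate the `d`-slot). Note only.
  - `IsSeparated f` / `QuasiCompact f`: the variants are again summit-type statements; not refutable here.
* §3 Line `Sketch` (PICKED 2026-08-16): worker stubs `stub_transport`, `stub_clause_of_ringEquiv` (both landed),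
  `stub_components`, `stub_rungsOfSummit` are TRUE; lead stubs `stub_weaklyFRegularModification` (rung 3½) and
  `stub_weaklyFRegularResolution` (rung 4′) are summit-implied open problems — no stub is refutable short of
  ¬summit; joint sufficiency is the lead's checked `FRationalResolution_of`. The calibration
  `NEGATIVE-suspension-calibration.md` (hyperbolic suspensions `yz + f` are strongly F-regular for every `f`)
  prices rung 4′ at summit strength two dimensions down; nothing in this file contradicts it.
* §4 Near-misses / not attempted: an F-rational NON-regular local ring in Lean (would show the residual class
  is non-trivial inside Lean; needs tight closure of `k[x,y,z]/(xy-z²)` — positive-side work, skipped);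
  dropping the CLAUSE itself (keeping proper + birational + locally integral) ⇔ summit:
  theorem `withoutTightClosure_iff_summit` (§2, via `resolutionOfSingularities_iff_integral`).
  SUMMARY OF §2: of the crux's hypotheses, `LocallyOfFiniteType` is refutably load-bearing, `IsProper`,
  `IsBirational` and the tight-closure clause EACH separate the crux from the full summit (drop any one and
  the statement is literally `ResolutionOfSingularities`), `IsReduced` is redundant, `p.Prime` is cosmetic;
  the residual content is exactly "F-rational (finite type) ⇒ resolvable".
* §5 Print search for a kill (2026-08-16; local searchd down — ConnectionReset —, OpenAlex 429): arXiv
  "F-rational resolution singularities" (20 rows: Tanaka 1502.07236 tautness of 2-dim F-regular/F-pure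
  rational singularities, Hsiao 1310.6473 matrix Schubert F-rationality, … — no statement either way on
  resolvability of F-rational varieties in dim ≥ 4), zbMATH "F-rational singularities resolution blow-up
  characteristic p" (1 row, irrelevant); `ledger negatives` for the summit: none touching F-singularities.
  As expected for a summit-implied statement: no counterexample can be in print unless resolution fails.
-/

set_option linter.dupNamespace false

noncomputable section

open CategoryTheory AlgebraicGeometry TopologicalSpace
open Literature.AlgebraicGeometry.Resolution Literature.RingTheory.TightClosure
open Summit.ResolutionOfSingularities.ResolutionOfSingularities.Theses.FrobeniusLadder (FRationalResolution)

namespace Summit.ResolutionOfSingularities.ResolutionOfSingularities.Cruxes.FRationalResolution.Disproof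

/-! ## §0 Sandwich: the crux is summit-implied; `IsReduced` is redundant -/

/-- UPPER BOUND: a refutation of the crux refutes the summit (the crux's conclusion is the summit's
conclusion for the same `X`, its extra hypothesis is discarded). Hence no refutation of
`FRationalResolution` exists unless resolution of singularities in positive characteristic fails. -/
theorem not_summit_of_not_fRationalResolution (h : ¬ FRationalResolution) :
    ¬ _root_.ResolutionOfSingularities := by
  intro hs
  apply h
  intro p hp k _ _ X f hsep hft hqc hred _
  exact (_root_.ResolutionOfSingularities_iff.mp hs) p hp k X f hsep hft hqc hred

/-- The crux's stalk clause for a scheme `X'` and an exponent base `p` (verbatim from the route file). -/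
def Clause (p : ℕ) (X' : Scheme.{0}) : Prop :=
  ∀ x : X', IsDomain (X'.presheaf.stalk x) ∧ ∀ d : ℕ, ringKrullDim (X'.presheaf.stalk x) = d →
    ∀ s : Fin d → X'.presheaf.stalk x, (Ideal.span (Set.range s)).radical.IsMaximal →
    ∀ y c : X'.presheaf.stalk x, c ≠ 0 →
    (∀ e : ℕ, c * y ^ p ^ e ∈ Ideal.span ((fun z : X'.presheaf.stalk x => z ^ p ^ e) ''
      (Ideal.span (Set.range s) : Set (X'.presheaf.stalk x)))) → y ∈ Ideal.span (Set.range s)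

/-- The crux, restated through `Clause` (definitional). -/
theorem fRationalResolution_iff_clause :
    FRationalResolution ↔ ∀ p : ℕ, p.Prime → ∀ (k : Type) [Field k] [CharP k p] (X : Scheme.{0})
      (f : X ⟶ Spec (.of k)), IsSeparated f → LocallyOfFiniteType f → QuasiCompact f → IsReduced X →
      (∃ (X' : Scheme.{0}) (π : X' ⟶ X), IsProper π ∧ IsBirational π ∧ Clause p X') →
      Scheme.HasResolution X :=
  Iff.rfl

/-- `IsReduced X` IS REDUNDANT: the crux implies its own variant with `IsReduced X` dropped. The model
`X'` has reduced stalks (domains), is separated and of finite type over `k` through `π ≫ f` (`π` proper),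
is its own F-rational model along `𝟙 X'`, so the crux resolves `X'`, and
`Scheme.HasResolution.of_isBirational` transports the resolution down `π`. -/
theorem fRationalResolution_imp_withoutReduced (h : FRationalResolution) :
    ∀ p : ℕ, p.Prime → ∀ (k : Type) [Field k] [CharP k p] (X : Scheme.{0})
      (f : X ⟶ Spec (.of k)), IsSeparated f → LocallyOfFiniteType f → QuasiCompact f →
      (∃ (X' : Scheme.{0}) (π : X' ⟶ X), IsProper π ∧ IsBirational π ∧ Clause p X') →
      Scheme.HasResolution X := by
  intro p hp k _ _ X f hsep hft hqc ⟨X', π, hπ, hbir, hcl⟩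
  haveI := hπ
  haveI := hsep
  haveI := hft
  haveI := hqc
  haveI : ∀ x : X', _root_.IsReduced (X'.presheaf.stalk x) := fun x => by
    haveI := (hcl x).1
    infer_instance
  have hred : IsReduced X' := isReduced_of_isReduced_stalk X'
  have hX' : Scheme.HasResolution X' := by
    refine h p hp k X' (π ≫ f) inferInstance inferInstance inferInstance hred
      ⟨X', 𝟙 X', inferInstance, ⟨⊤, ?_, ?_, ?_⟩, hcl⟩
    · simp
    · simp
    · infer_instance
  exact Scheme.HasResolution.of_isBirational π hbir hX'

/-! ## §1 Faithfulness of the typed clause -/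

/-- `∀ e ≥ e₀` upgrades to `∀ e ≥ 0` in a domain (replace `c` by `c·y^(p^e₀)`): the route's inline
"tightly closed" (all `e`) is the textbook tight closure (`e ≫ 0`) for the domain stalks it is applied to. -/
theorem exists_forall_of_eventually {A : Type*} [CommRing A] [IsDomain A] {p : ℕ} (hp : 0 < p)
    (I : Ideal A) {y c : A} (hc : c ≠ 0) (e₀ : ℕ)
    (h : ∀ e, e₀ ≤ e → c * y ^ p ^ e ∈ Ideal.span ((fun z : A => z ^ p ^ e) '' (I : Set A))) :
    ∃ c' : A, c' ≠ 0 ∧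
      ∀ e, c' * y ^ p ^ e ∈ Ideal.span ((fun z : A => z ^ p ^ e) '' (I : Set A)) := by
  by_cases hy : y = 0
  · refine ⟨c, hc, fun e => ?_⟩
    rw [hy, zero_pow (pow_ne_zero _ hp.ne'), mul_zero]
    exact Ideal.zero_mem _
  refine ⟨c * y ^ p ^ e₀, mul_ne_zero hc (pow_ne_zero _ hy), fun e => ?_⟩
  rcases le_or_gt e₀ e with hle | hlt
  · rw [mul_assoc, mul_comm (y ^ p ^ e₀), ← mul_assoc]
    exact Ideal.mul_mem_right _ _ (h e hle)
  · have hsub : Ideal.span ((fun z : A => z ^ p ^ e₀) '' (I : Set A)) ≤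
        Ideal.span ((fun z : A => z ^ p ^ e) '' (I : Set A)) := by
      refine Ideal.span_le.mpr ?_
      rintro _ ⟨z, hz, rfl⟩
      obtain ⟨m, hm⟩ : p ^ e ∣ p ^ e₀ := pow_dvd_pow p hlt.le
      have hm1 : 1 ≤ m := by
        rcases Nat.eq_zero_or_pos m with h0 | h0
        · rw [h0, mul_zero] at hm; exact absurd hm (pow_ne_zero _ hp.ne')
        · exact h0
      have hz' : z ^ p ^ e₀ = z ^ p ^ e * z ^ (p ^ e * (m - 1)) := by
        rw [← pow_add, hm]
        congr 1
        rcases Nat.exists_eq_add_of_le hm1 with ⟨m', rfl⟩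
        simp [Nat.mul_add, Nat.add_comm]
      show z ^ p ^ e₀ ∈ Ideal.span ((fun z : A => z ^ p ^ e) '' (I : Set A))
      rw [hz']
      exact Ideal.mul_mem_right _ _ (Ideal.subset_span ⟨z, hz, rfl⟩)
    exact Ideal.mul_mem_right _ _ (hsub (h e₀ le_rfl))

/-- Dimension-0 stalks (fields) satisfy the clause (through `e = 0`: `c·y ∈ (0) ⇒ y = 0`); in particular
the hypothesis of the crux is never vacuous at generic points. -/
theorem clause_of_field (p : ℕ) (K : Type) [Field K] :
    IsDomain K ∧ ∀ d : ℕ, ringKrullDim K = d → ∀ s : Fin d → K,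
      (Ideal.span (Set.range s)).radical.IsMaximal → ∀ y c : K, c ≠ 0 →
      (∀ e : ℕ, c * y ^ p ^ e ∈ Ideal.span ((fun z : K => z ^ p ^ e) ''
        (Ideal.span (Set.range s) : Set K))) → y ∈ Ideal.span (Set.range s) := by
  refine ⟨inferInstance, fun d _ s hmax y c hc h => ?_⟩
  have hI : Ideal.span (Set.range s) = ⊥ := by
    have h1 : (Ideal.span (Set.range s)).radical = ⊥ := Ideal.eq_bot_of_prime _
    exact le_bot_iff.mp (h1 ▸ Ideal.le_radical)
  have h0 := h 0
  rw [hI] at h0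
  have hle : Ideal.span ((fun z : K => z ^ p ^ 0) '' ((⊥ : Ideal K) : Set K)) ≤ ⊥ := by
    rw [Ideal.span_le]
    rintro _ ⟨z, hz, rfl⟩
    have hz0 : z = 0 := by simpa using hz
    simp [hz0]
  have h00 : c * y ^ p ^ 0 = 0 := by simpa using hle h0
  rw [pow_zero, pow_one] at h00
  rw [hI, (mul_eq_zero.mp h00).resolve_left hc]
  exact Ideal.zero_mem _

/-- WHAT THE CLAUSE FORCES BEYOND NOETHERIANITY: if the clause holds in dimension-slot `d ≥ 1`, then for
every `t` with `√(t) = 𝔪` no `c ≠ 0` lies in all `(tⁿ)` (take `s ≡ t`, `y = 1`). For Noetherian local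
rings this is Krull's intersection theorem; for non-Noetherian stalks it is a genuine restriction
(valuation rings of rank ≥ 2 violate it, rank-1 ones do not) — the shape exploited by
`fRationalResolution_false_without_locallyOfFiniteType`. -/
theorem not_forall_mem_span_pow_of_clause {A : Type*} [CommRing A] (p : ℕ) {d : ℕ} (hd : 0 < d)
    (hcl : ∀ s : Fin d → A, (Ideal.span (Set.range s)).radical.IsMaximal → ∀ y c : A, c ≠ 0 →
      (∀ e : ℕ, c * y ^ p ^ e ∈ Ideal.span ((fun z : A => z ^ p ^ e) ''
        (Ideal.span (Set.range s) : Set A))) → y ∈ Ideal.span (Set.range s))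
    (t : A) (ht : (Ideal.span {t}).radical.IsMaximal) (c : A) (hc : c ≠ 0) :
    ¬ ∀ n : ℕ, c ∈ Ideal.span {t ^ n} := by
  intro hmem
  haveI : Nonempty (Fin d) := ⟨⟨0, hd⟩⟩
  have hrange : Set.range (fun _ : Fin d => t) = {t} := Set.range_const
  have h1 : (1 : A) ∈ Ideal.span {t} := by
    have := hcl (fun _ => t) (by rw [hrange]; exact ht) 1 c hc (fun e => ?_)
    · rwa [hrange] at this
    rw [one_pow, mul_one, hrange]
    refine Ideal.span_mono ?_ (hmem (p ^ e))
    rintro _ rfl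
    exact ⟨t, Ideal.mem_span_singleton_self t, rfl⟩
  exact ht.ne_top ((Ideal.radical_eq_top).mpr ((Ideal.eq_top_iff_one _).mpr h1))

/-! ## §2 Load-bearing hypotheses as theorems -/

/-- The crux with `LocallyOfFiniteType f` DROPPED (everything else verbatim). -/
def FRationalResolutionWithoutLocallyOfFiniteType : Prop :=
  ∀ p : ℕ, p.Prime → ∀ (k : Type) [Field k] [CharP k p] (X : Scheme.{0}) (f : X ⟶ Spec (.of k)),
    IsSeparated f → QuasiCompact f → IsReduced X →
    (∃ (X' : Scheme.{0}) (π : X' ⟶ X), IsProper π ∧ IsBirational π ∧ Clause p X') →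
    Scheme.HasResolution X

/-- ANY PROOF MUST USE `LocallyOfFiniteType f`: the finite-type-free variant is false (landed Negative lemma
`Negative.fRationalResolution_false_without_locallyOfFiniteType`; witness `Spec (PerfectClosure 𝔽_p[X] p)`
with the identity as its own F-rational model). -/
theorem fRationalResolution_false_without_locallyOfFiniteType :
    ¬ FRationalResolutionWithoutLocallyOfFiniteType := by
  intro h
  refine Theorems.FRationalResolution.Negative.fRationalResolution_false_without_locallyOfFiniteType ?_
  intro p hp k _ _ X f hsep hqc hred hmodel
  exact h p hp k X f hsep hqc hred hmodel

/-- The crux with `IsReduced X` DROPPED. -/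
def FRationalResolutionWithoutIsReduced : Prop :=
  ∀ p : ℕ, p.Prime → ∀ (k : Type) [Field k] [CharP k p] (X : Scheme.{0}) (f : X ⟶ Spec (.of k)),
    IsSeparated f → LocallyOfFiniteType f → QuasiCompact f →
    (∃ (X' : Scheme.{0}) (π : X' ⟶ X), IsProper π ∧ IsBirational π ∧ Clause p X') →
    Scheme.HasResolution X

/-- `IsReduced X` is NOT load-bearing: the crux is EQUIVALENT to its variant without it
(`fRationalResolution_imp_withoutReduced` and the trivial converse). -/
theorem fRationalResolution_iff_withoutIsReduced :
    FRationalResolution ↔ FRationalResolutionWithoutIsReduced := by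
  constructor
  · exact fun h => fRationalResolution_imp_withoutReduced h
  · intro h p hp k _ _ X f hsep hft hqc _ hmodel
    exact h p hp k X f hsep hft hqc hmodel


/-- The crux with `IsBirational π` DROPPED. -/
def FRationalResolutionWithoutIsBirational : Prop :=
  ∀ p : ℕ, p.Prime → ∀ (k : Type) [Field k] [CharP k p] (X : Scheme.{0}) (f : X ⟶ Spec (.of k)),
    IsSeparated f → LocallyOfFiniteType f → QuasiCompact f → IsReduced X →
    (∃ (X' : Scheme.{0}) (π : X' ⟶ X), IsProper π ∧ Clause p X') →
    Scheme.HasResolution X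

/-- `IsBirational π` IS LOAD-BEARING in the strongest sense: without it the crux is LITERALLY the summit
(the empty scheme is then a proper — closed immersion — model of every `X`, with vacuous clause). So the
birationality of the model is the only thing that keeps rank 4 below the summit besides the clause itself;
and WITH it `X' = ∅` is not a junk model (a dense `U` with `π ∣_ U` an iso from `∅` forces `X = ∅`). -/
theorem withoutIsBirational_iff_summit :
    FRationalResolutionWithoutIsBirational ↔ _root_.ResolutionOfSingularities := by
  constructor
  · intro h
    rw [_root_.ResolutionOfSingularities_iff]
    intro p hp k _ _ X f hsep hft hqc hred
    exact h p hp k X f hsep hft hqc hred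
      ⟨∅, Scheme.emptyTo X, inferInstance, fun x => (IsEmpty.false x).elim⟩
  · intro hs p hp k _ _ X f hsep hft hqc hred _
    exact (_root_.ResolutionOfSingularities_iff.mp hs) p hp k X f hsep hft hqc hred

/-- The crux with `IsProper π` DROPPED. -/
def FRationalResolutionWithoutIsProper : Prop :=
  ∀ p : ℕ, p.Prime → ∀ (k : Type) [Field k] [CharP k p] (X : Scheme.{0}) (f : X ⟶ Spec (.of k)),
    IsSeparated f → LocallyOfFiniteType f → QuasiCompact f → IsReduced X →
    (∃ (X' : Scheme.{0}) (π : X' ⟶ X), IsBirational π ∧ Clause p X') →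
    Scheme.HasResolution X

/-- Regular local rings of characteristic `p` satisfy the clause (every ideal is tightly closed:
`isTightlyClosed_of_isRegularLocalRing`, Kunz + Krull, proved in the tree). -/
theorem clause_of_isRegularLocalRing (p : ℕ) [Fact p.Prime] {R : Type} [CommRing R] [CharP R p]
    [IsRegularLocalRing R] :
    IsDomain R ∧ ∀ d : ℕ, ringKrullDim R = d → ∀ s : Fin d → R,
      (Ideal.span (Set.range s)).radical.IsMaximal → ∀ y c : R, c ≠ 0 →
      (∀ e : ℕ, c * y ^ p ^ e ∈ Ideal.span ((fun z : R => z ^ p ^ e) ''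
        (Ideal.span (Set.range s) : Set R))) → y ∈ Ideal.span (Set.range s) := by
  haveI : IsDomain R := isDomain_of_isRegularLocalRing R
  exact ⟨inferInstance, fun d _ s _ =>
    (isTightlyClosed_iff_of_isDomain p).mp (isTightlyClosed_of_isRegularLocalRing p _)⟩

/-- `IsProper π` IS LOAD-BEARING in the strongest sense: without it the crux is LITERALLY the summit —
the REGULAR LOCUS `Reg X ↪ X` is then an F-rational model of every reduced finite-type `X/k`
(open: `isOpen_regularLocus_of_locallyOfFiniteType_field`, Matsumura 30.5 Cor., in the tree; dense:
`Scheme.dense_regularLocus`; an open immersion is an isomorphism over its image; regular stalks satisfy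
the clause, `clause_of_isRegularLocalRing`). -/
theorem withoutIsProper_iff_summit :
    FRationalResolutionWithoutIsProper ↔ _root_.ResolutionOfSingularities := by
  constructor
  · intro h
    rw [_root_.ResolutionOfSingularities_iff]
    intro p hp k _ _ X f hsep hft hqc hred
    haveI := hft
    haveI := hred
    haveI : Fact p.Prime := ⟨hp⟩
    let U : X.Opens := ⟨Scheme.regularLocus X, isOpen_regularLocus_of_locallyOfFiniteType_field f⟩
    refine h p hp k X f hsep hft hqc hred ⟨U, U.ι, ⟨U, ?_, ?_, ?_⟩, fun u => ?_⟩
    · exact Scheme.dense_regularLocus X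
    · rw [Scheme.Opens.ι_preimage_self]
      simp
    · haveI : Epi (U.ι ∣_ U).base := (TopCat.epi_iff_surjective _).mpr fun y =>
        ⟨⟨y, show U.ι y ∈ U from y.2⟩, Subtype.ext (morphismRestrict_base_coe U.ι U _)⟩
      exact IsOpenImmersion.isIso (U.ι ∣_ U)
    · have hu : IsRegularLocalRing (X.presheaf.stalk (U.ι u)) := u.2
      haveI : IsRegularLocalRing ((U : Scheme.{0}).presheaf.stalk u) :=
        IsRegularLocalRing.of_ringEquiv (asIso (U.ι.stalkMap u)).commRingCatIsoToRingEquiv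
      haveI : CharP ((U : Scheme.{0}).presheaf.stalk u) p :=
        Theorems.FRationalResolution.RungsOfSummit.charP_stalk_of_over hp.ne_zero k (U.ι ≫ f) u
      exact clause_of_isRegularLocalRing p
  · intro hs p hp k _ _ X f hsep hft hqc hred _
    exact (_root_.ResolutionOfSingularities_iff.mp hs) p hp k X f hsep hft hqc hred

/-- The crux with the F-RATIONALITY CLAUSE DROPPED (keeping "proper birational LOCALLY INTEGRAL model"). -/
def FRationalResolutionWithoutTightClosure : Prop :=
  ∀ p : ℕ, p.Prime → ∀ (k : Type) [Field k] [CharP k p] (X : Scheme.{0}) (f : X ⟶ Spec (.of k)),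
    IsSeparated f → LocallyOfFiniteType f → QuasiCompact f → IsReduced X →
    (∃ (X' : Scheme.{0}) (π : X' ⟶ X), IsProper π ∧ IsBirational π ∧
      ∀ x : X', IsDomain (X'.presheaf.stalk x)) →
    Scheme.HasResolution X

/-- The TIGHT-CLOSURE CLAUSE carries the whole reduction: with it dropped (only "locally integral
proper birational model" kept) the statement is again LITERALLY the summit — an integral `X` is its own
locally integral model along `𝟙 X`, and the summit is equivalent to its integral case
(`resolutionOfSingularities_iff_integral`, in the tree). -/
theorem withoutTightClosure_iff_summit :
    FRationalResolutionWithoutTightClosure ↔ _root_.ResolutionOfSingularities := by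
  constructor
  · intro h
    rw [show _root_.ResolutionOfSingularities =
      Literature.AlgebraicGeometry.Resolution.ResolutionOfSingularities from rfl,
      resolutionOfSingularities_iff_integral]
    intro p hp k _ _ X f hsep hft hqc hint
    haveI := hint
    refine h p hp k X f hsep hft hqc inferInstance ⟨X, 𝟙 X, inferInstance, ⟨⊤, ?_, ?_, ?_⟩,
      fun x => inferInstance⟩
    · simp
    · simp
    · infer_instance
  · intro hs p hp k _ _ X f hsep hft hqc hred _
    exact (_root_.ResolutionOfSingularities_iff.mp hs) p hp k X f hsep hft hqc hred

end Summit.ResolutionOfSingularities.ResolutionOfSingularities.Cruxes.FRationalResolution.Disproof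

end
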